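import Summits.ValiantsHypothesis.ValiantsHypothesis.Theorems.FeketeSOSFeketeSOSHardPaleyRIPFlatRIPPolarisation
import Mathlib.Analysis.SpecialFunctions.Pow.Real

/-!
# Route FeketeSOS — crux `FeketeSOSHard` (stmt-ValiantsHypothesis-3996), line `paley-rip`,
# stub `stub_paleyFlatRIP`: TRADING support for saving — `(κ, δ₁) ⇒ (κ − 2η, δ₁ + η)`

The engine `stub_paleyFlatRIP` (PaleyRIP beyond `√p`; OPEN) has two exponents: the saving `κ` and the
support excess `δ₁` (`|Q_p(S,w)| ≤ p^{1/2−κ}Σ|w_a|²` for `#S ≤ p^{1/2+δ₁}`).  This file proves, sorry-free,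
that the second can be bought with the first: restricted-isometry-type constants grow at most linearly
in the order, so flatness on supports `≤ p^{1/2+δ₁}` propagates to supports `≤ p^{1/2+δ₁+η}` at the cost
of a factor `≍ p^{η}`.

* `norm_paleyBilin_block_le`, `norm_paleyBilin_pieces_le`, `norm_paleyForm_pieces_le` — **PEELING /
  BLOCK-NORM BOUND**: if every `T ⊆ U` with `#T ≤ 2h` carries the quadratic bound `θ`, then every
  `S ⊆ U` with `#S ≤ k·h` carries `k·θ` (`|Q| ≤ θ(Σ_i‖w_i‖)² ≤ θ·k·Σ_i‖w_i‖²` over `k` pieces of size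
  `≤ h`; peel one piece at a time, polarisation + Cauchy–Schwarz);
* `flatRIPAt_trade` — at one prime: the engine's inequality with `(κ, δ₁)` (`p^{1/2+δ₁} ≥ 4`) gives
  `|Q_p(S,w)| ≤ 5p^{η}·p^{1/2−κ}·Σ|w_a|²` for all `S ⊆ [0,p)` with `#S ≤ p^{1/2+δ₁+η}`, `η ≥ 0`;
* `flatRIP_trade`, `flatRIP_admissible_trade`, `flatRIPAt_mono` — asymptotically: `(κ, δ₁)` admissible
  ⇒ `(κ − 2η, δ₁ + η)` admissible (`0 < η < κ/2`), and trivially every weaker pair; so the admissible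
  region is determined, up to the factor `2`, by the best saving at supports just above `√p` (with the
  floor `κ + δ₁/2 ≤ 1/4` of `…PaleyRIPNormFloor.lean`); which pairs ARE admissible is the open problem.

Honest framing: structure of an OPEN statement's parameter set, landed `--supports` the crux item; the
crux `FeketeSOSHard`, the engine and `stub_tameOperator` remain open; nothing here bears on `VP ≠ VNP`.
-/

-- the line's namespace repeats a path segment by convention (same as the other paley-rip files)
set_option linter.dupNamespace false

namespace Summit.ValiantsHypothesis.ValiantsHypothesis.Theorems.FeketeSOSHardPaleyRIP

open Finset
open scoped BigOperators

noncomputable section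

section Pieces

variable (p : ℕ) [Fact p.Prime]

/-- Bilinear Paley–Hankel sums against weights cut off to `A, R ⊆ T` are the plain bilinear sums over
`A × R`. [folklore] -/
theorem paleyBilin_restrict (T A R : Finset ℕ) (hA : A ⊆ T) (hR : R ⊆ T) (u v : ℕ → ℂ) :
    ∑ a ∈ T, ∑ b ∈ T, ((legendreSym p ((a : ℤ) + b) : ℤ) : ℂ) * (if a ∈ A then u a else 0) *
        (if b ∈ R then v b else 0) =
      ∑ a ∈ A, ∑ b ∈ R, ((legendreSym p ((a : ℤ) + b) : ℤ) : ℂ) * u a * v b := by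
  classical
  have hterm : ∀ a b : ℕ, ((legendreSym p ((a : ℤ) + b) : ℤ) : ℂ) * (if a ∈ A then u a else 0) *
      (if b ∈ R then v b else 0) =
      if a ∈ A then (if b ∈ R then ((legendreSym p ((a : ℤ) + b) : ℤ) : ℂ) * u a * v b else 0)
      else 0 := by
    intro a b
    split_ifs <;> simp
  simp_rw [hterm]
  have hout : ∀ a ∈ T, (∑ b ∈ T, if a ∈ A then
      (if b ∈ R then ((legendreSym p ((a : ℤ) + b) : ℤ) : ℂ) * u a * v b else 0) else 0) =
      if a ∈ A then ∑ b ∈ R, ((legendreSym p ((a : ℤ) + b) : ℤ) : ℂ) * u a * v b else 0 := by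
    intro a _
    split_ifs with ha
    · rw [← sum_filter, Finset.filter_mem_eq_inter, inter_eq_right.2 hR]
    · simp
  rw [sum_congr rfl hout, ← sum_filter, Finset.filter_mem_eq_inter, inter_eq_right.2 hA]

omit [Fact p.Prime] in
/-- Cut-off weights have `Σ_{a∈T} |u·1_A(a)|² = Σ_{a∈A} |u_a|²` for `A ⊆ T`. [folklore] -/
theorem sum_norm_sq_restrict (T A : Finset ℕ) (hA : A ⊆ T) (u : ℕ → ℂ) :
    ∑ a ∈ T, ‖(if a ∈ A then u a else 0)‖ ^ 2 = ∑ a ∈ A, ‖u a‖ ^ 2 := by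
  classical
  have h : ∀ a ∈ T, ‖(if a ∈ A then u a else 0)‖ ^ 2 = if a ∈ A then ‖u a‖ ^ 2 else 0 := by
    intro a _; split_ifs <;> simp
  rw [sum_congr rfl h, ← sum_filter, Finset.filter_mem_eq_inter, inter_eq_right.2 hA]

/-- **Base piece.** A quadratic bound `θ` on `A ∪ R` bounds the bilinear block `A × R`:
`|Σ_{a∈A,b∈R} χ_p(a+b) u_a v_b| ≤ θ ‖u‖_A ‖v‖_R` (polarisation, `norm_paleyBilin_le_of_quad`).
[folklore] -/
theorem norm_paleyBilin_block_le (θ : ℝ) (A R : Finset ℕ)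
    (hQ : ∀ w : ℕ → ℂ, ‖paleyForm p (A ∪ R) w‖ ≤ θ * ∑ a ∈ A ∪ R, ‖w a‖ ^ 2) (u v : ℕ → ℂ) :
    ‖∑ a ∈ A, ∑ b ∈ R, ((legendreSym p ((a : ℤ) + b) : ℤ) : ℂ) * u a * v b‖ ≤
      θ * Real.sqrt (∑ a ∈ A, ‖u a‖ ^ 2) * Real.sqrt (∑ b ∈ R, ‖v b‖ ^ 2) := by
  classical
  have h := norm_paleyBilin_le_of_quad p θ (A ∪ R) hQ (fun a => if a ∈ A then u a else 0)
    (fun b => if b ∈ R then v b else 0)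
  rwa [paleyBilin_restrict p (A ∪ R) A R subset_union_left subset_union_right,
    sum_norm_sq_restrict (A ∪ R) A subset_union_left,
    sum_norm_sq_restrict (A ∪ R) R subset_union_right] at h

/-- Cauchy–Schwarz step of the peeling: `X + √k·Y ≤ √(k+1)·√(X² + Y²)` (`k ≥ 0`). [folklore] -/
theorem add_sqrt_mul_le (k X Y : ℝ) (hk : 0 ≤ k) :
    X + Real.sqrt k * Y ≤ Real.sqrt (k + 1) * Real.sqrt (X ^ 2 + Y ^ 2) := by
  rw [← Real.sqrt_mul (by linarith)]
  apply Real.le_sqrt_of_sq_le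
  have hsk : Real.sqrt k ^ 2 = k := Real.sq_sqrt hk
  nlinarith [sq_nonneg (Real.sqrt k * X - Y), Real.sqrt_nonneg k]

/-- Piece arithmetic: removing `min(h, m)` elements from `m ≤ (k+1)h` leaves `≤ kh`. [folklore] -/
theorem sub_min_le_of_le_succ_mul (m h k : ℕ) (hm : m ≤ (k + 1) * h) : m - min h m ≤ k * h := by
  rcases le_total h m with hle | hle
  · rw [min_eq_left hle]
    have e : (k + 1) * h = k * h + h := by ring
    omega
  · rw [min_eq_right hle]; simp

/-- **Peeling, bilinear.**  If every `T ⊆ U` with `#T ≤ 2h` carries the quadratic bound `θ ≥ 0`, then for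
`A ⊆ U` with `#A ≤ h` and `R ⊆ U` with `#R ≤ k·h`:
`|Σ_{a∈A,b∈R} χ_p(a+b) u_a v_b| ≤ θ √k ‖u‖_A ‖v‖_R` (peel `R` into `k` pieces of size `≤ h`; Cauchy–Schwarz).
[folklore] -/
theorem norm_paleyBilin_pieces_le (θ : ℝ) (hθ : 0 ≤ θ) (h : ℕ) (U : Finset ℕ)
    (hQ : ∀ T ⊆ U, T.card ≤ 2 * h → ∀ w : ℕ → ℂ, ‖paleyForm p T w‖ ≤ θ * ∑ a ∈ T, ‖w a‖ ^ 2)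
    (A : Finset ℕ) (hAU : A ⊆ U) (hA : A.card ≤ h) :
    ∀ (k : ℕ) (R : Finset ℕ), R ⊆ U → R.card ≤ k * h → ∀ (u v : ℕ → ℂ),
      ‖∑ a ∈ A, ∑ b ∈ R, ((legendreSym p ((a : ℤ) + b) : ℤ) : ℂ) * u a * v b‖ ≤
        θ * Real.sqrt k * Real.sqrt (∑ a ∈ A, ‖u a‖ ^ 2) * Real.sqrt (∑ b ∈ R, ‖v b‖ ^ 2) := by
  classical
  intro k
  induction k with
  | zero =>
    intro R _ hR u v
    have hR0 : R = ∅ := card_eq_zero.1 (by simpa using hR)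
    subst hR0
    simp
  | succ k ih =>
    intro R hRU hR u v
    -- peel a piece `R₁ ⊆ R` of size `min h #R`
    obtain ⟨R₁, hR₁R, hR₁card⟩ := exists_subset_card_eq (s := R) (n := min h R.card) (min_le_right _ _)
    set R' : Finset ℕ := R \ R₁ with hR'
    have hR'card : R'.card ≤ k * h := by
      rw [hR', card_sdiff_of_subset hR₁R, hR₁card]; exact sub_min_le_of_le_succ_mul _ h k hR
    have hR₁h : R₁.card ≤ h := by rw [hR₁card]; exact min_le_left _ _
    have hR'U : R' ⊆ U := (sdiff_subset).trans hRU
    -- split the sum over `R = R' ⊔ R₁`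
    have hsplit : ∑ a ∈ A, ∑ b ∈ R, ((legendreSym p ((a : ℤ) + b) : ℤ) : ℂ) * u a * v b =
        (∑ a ∈ A, ∑ b ∈ R', ((legendreSym p ((a : ℤ) + b) : ℤ) : ℂ) * u a * v b) +
        ∑ a ∈ A, ∑ b ∈ R₁, ((legendreSym p ((a : ℤ) + b) : ℤ) : ℂ) * u a * v b := by
      rw [← sum_add_distrib]
      refine sum_congr rfl fun a _ => ?_
      rw [hR', sum_sdiff hR₁R]
    -- the two bounds
    have h1 : ‖∑ a ∈ A, ∑ b ∈ R₁, ((legendreSym p ((a : ℤ) + b) : ℤ) : ℂ) * u a * v b‖ ≤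
        θ * Real.sqrt (∑ a ∈ A, ‖u a‖ ^ 2) * Real.sqrt (∑ b ∈ R₁, ‖v b‖ ^ 2) := by
      refine norm_paleyBilin_block_le p θ A R₁ (hQ (A ∪ R₁) (union_subset hAU (hR₁R.trans hRU)) ?_) u v
      calc (A ∪ R₁).card ≤ A.card + R₁.card := card_union_le _ _
        _ ≤ h + h := add_le_add hA hR₁h
        _ = 2 * h := by ring
    have h2 := ih R' hR'U hR'card u v
    -- norms on `R`, `R'`, `R₁`
    set X : ℝ := Real.sqrt (∑ b ∈ R₁, ‖v b‖ ^ 2) with hX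
    set Y : ℝ := Real.sqrt (∑ b ∈ R', ‖v b‖ ^ 2) with hY
    set Nu : ℝ := Real.sqrt (∑ a ∈ A, ‖u a‖ ^ 2) with hNu
    have hNu0 : 0 ≤ Nu := Real.sqrt_nonneg _
    have hsumR : ∑ b ∈ R, ‖v b‖ ^ 2 = X ^ 2 + Y ^ 2 := by
      rw [hX, hY, Real.sq_sqrt (sum_nonneg fun _ _ => sq_nonneg _),
        Real.sq_sqrt (sum_nonneg fun _ _ => sq_nonneg _), hR', add_comm, sum_sdiff hR₁R]
    have hcs := add_sqrt_mul_le (k : ℝ) X Y (Nat.cast_nonneg k)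
    rw [hsplit, hsumR]
    calc ‖(∑ a ∈ A, ∑ b ∈ R', ((legendreSym p ((a : ℤ) + b) : ℤ) : ℂ) * u a * v b) +
          ∑ a ∈ A, ∑ b ∈ R₁, ((legendreSym p ((a : ℤ) + b) : ℤ) : ℂ) * u a * v b‖
        ≤ θ * Real.sqrt k * Nu * Y + θ * Nu * X := (norm_add_le _ _).trans (add_le_add h2 h1)
      _ = θ * Nu * (X + Real.sqrt k * Y) := by ring
      _ ≤ θ * Nu * (Real.sqrt ((k : ℝ) + 1) * Real.sqrt (X ^ 2 + Y ^ 2)) :=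
          mul_le_mul_of_nonneg_left hcs (mul_nonneg hθ hNu0)
      _ = θ * Real.sqrt ((k + 1 : ℕ) : ℝ) * Nu * Real.sqrt (X ^ 2 + Y ^ 2) := by
          push_cast; ring

/-- Splitting the Paley–Hankel form along `S = (S \ S₁) ⊔ S₁`: two principal forms and the two
(equal) cross blocks. [folklore] -/
theorem paleyForm_split (S S₁ : Finset ℕ) (h : S₁ ⊆ S) (w : ℕ → ℂ) :
    paleyForm p S w = paleyForm p (S \ S₁) w + paleyForm p S₁ w +
      (∑ a ∈ S \ S₁, ∑ b ∈ S₁, ((legendreSym p ((a : ℤ) + b) : ℤ) : ℂ) * w a * w b) +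
      ∑ a ∈ S₁, ∑ b ∈ S \ S₁, ((legendreSym p ((a : ℤ) + b) : ℤ) : ℂ) * w a * w b := by
  classical
  unfold paleyForm
  rw [← sum_sdiff h]
  have inner : ∀ a : ℕ, ∑ b ∈ S, ((legendreSym p ((a : ℤ) + b) : ℤ) : ℂ) * w a * w b =
      (∑ b ∈ S \ S₁, ((legendreSym p ((a : ℤ) + b) : ℤ) : ℂ) * w a * w b) +
      ∑ b ∈ S₁, ((legendreSym p ((a : ℤ) + b) : ℤ) : ℂ) * w a * w b := fun a => (sum_sdiff h).symm
  simp_rw [inner]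
  rw [sum_add_distrib, sum_add_distrib]
  ring

/-- The cross blocks are equal (the kernel `χ_p(a+b)` is symmetric). [folklore] -/
theorem paleyBilin_swap (A R : Finset ℕ) (w : ℕ → ℂ) :
    ∑ a ∈ R, ∑ b ∈ A, ((legendreSym p ((a : ℤ) + b) : ℤ) : ℂ) * w a * w b =
      ∑ a ∈ A, ∑ b ∈ R, ((legendreSym p ((a : ℤ) + b) : ℤ) : ℂ) * w a * w b := by
  rw [sum_comm]
  refine sum_congr rfl fun a _ => sum_congr rfl fun b _ => ?_
  rw [add_comm (b : ℤ) a]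
  ring

/-- **Peeling, quadratic (the block-norm bound).**  If every `T ⊆ U` with `#T ≤ 2h` carries the
quadratic bound `θ ≥ 0`, then every `S ⊆ U` with `#S ≤ k·h` carries the bound `k·θ`:
`|Q_p(S,w)| ≤ θ·k·Σ_{a∈S}|w_a|²`.  (Operator form: a symmetric matrix cut into `k × k` blocks of norm
`≤ θ` has norm `≤ kθ`; here `|Q| ≤ θ(Σ_i ‖w_i‖)² ≤ θ k Σ_i ‖w_i‖²` by peeling one piece at a time.)
[folklore] -/
theorem norm_paleyForm_pieces_le (θ : ℝ) (hθ : 0 ≤ θ) (h : ℕ) (U : Finset ℕ)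
    (hQ : ∀ T ⊆ U, T.card ≤ 2 * h → ∀ w : ℕ → ℂ, ‖paleyForm p T w‖ ≤ θ * ∑ a ∈ T, ‖w a‖ ^ 2) :
    ∀ (k : ℕ) (S : Finset ℕ), S ⊆ U → S.card ≤ k * h → ∀ (w : ℕ → ℂ),
      ‖paleyForm p S w‖ ≤ θ * k * ∑ a ∈ S, ‖w a‖ ^ 2 := by
  classical
  intro k
  induction k with
  | zero =>
    intro S _ hS w
    have hS0 : S = ∅ := card_eq_zero.1 (by simpa using hS)
    subst hS0
    simp [paleyForm]
  | succ k ih =>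
    intro S hSU hS w
    obtain ⟨S₁, hS₁S, hS₁card⟩ := exists_subset_card_eq (s := S) (n := min h S.card) (min_le_right _ _)
    set S' : Finset ℕ := S \ S₁ with hS'
    have hS'card : S'.card ≤ k * h := by
      rw [hS', card_sdiff_of_subset hS₁S, hS₁card]; exact sub_min_le_of_le_succ_mul _ h k hS
    have hS₁h : S₁.card ≤ h := by rw [hS₁card]; exact min_le_left _ _
    have hS₁U : S₁ ⊆ U := hS₁S.trans hSU
    have hS'U : S' ⊆ U := (sdiff_subset).trans hSU
    -- the four pieces
    have hQ1 : ‖paleyForm p S₁ w‖ ≤ θ * ∑ a ∈ S₁, ‖w a‖ ^ 2 := hQ S₁ hS₁U (by omega) w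
    have hQ' : ‖paleyForm p S' w‖ ≤ θ * k * ∑ a ∈ S', ‖w a‖ ^ 2 := ih S' hS'U hS'card w
    have hB : ‖∑ a ∈ S₁, ∑ b ∈ S', ((legendreSym p ((a : ℤ) + b) : ℤ) : ℂ) * w a * w b‖ ≤
        θ * Real.sqrt k * Real.sqrt (∑ a ∈ S₁, ‖w a‖ ^ 2) * Real.sqrt (∑ b ∈ S', ‖w b‖ ^ 2) :=
      norm_paleyBilin_pieces_le p θ hθ h U hQ S₁ hS₁U hS₁h k S' hS'U hS'card w w
    have hB' : ‖∑ a ∈ S', ∑ b ∈ S₁, ((legendreSym p ((a : ℤ) + b) : ℤ) : ℂ) * w a * w b‖ ≤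
        θ * Real.sqrt k * Real.sqrt (∑ a ∈ S₁, ‖w a‖ ^ 2) * Real.sqrt (∑ b ∈ S', ‖w b‖ ^ 2) := by
      rw [paleyBilin_swap p S₁ S' w]; exact hB
    -- assemble
    set X : ℝ := Real.sqrt (∑ a ∈ S₁, ‖w a‖ ^ 2) with hX
    set Y : ℝ := Real.sqrt (∑ b ∈ S', ‖w b‖ ^ 2) with hY
    have hX2 : X ^ 2 = ∑ a ∈ S₁, ‖w a‖ ^ 2 := Real.sq_sqrt (sum_nonneg fun _ _ => sq_nonneg _)
    have hY2 : Y ^ 2 = ∑ b ∈ S', ‖w b‖ ^ 2 := Real.sq_sqrt (sum_nonneg fun _ _ => sq_nonneg _)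
    have hsumS : ∑ a ∈ S, ‖w a‖ ^ 2 = X ^ 2 + Y ^ 2 := by rw [hX2, hY2, hS', add_comm, sum_sdiff hS₁S]
    have hsk : Real.sqrt (k : ℝ) ^ 2 = k := Real.sq_sqrt (Nat.cast_nonneg k)
    rw [paleyForm_split p S S₁ hS₁S w, hsumS]
    rw [← hX2] at hQ1; rw [← hY2] at hQ'
    calc ‖paleyForm p (S \ S₁) w + paleyForm p S₁ w +
          (∑ a ∈ S \ S₁, ∑ b ∈ S₁, ((legendreSym p ((a : ℤ) + b) : ℤ) : ℂ) * w a * w b) +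
          ∑ a ∈ S₁, ∑ b ∈ S \ S₁, ((legendreSym p ((a : ℤ) + b) : ℤ) : ℂ) * w a * w b‖
        ≤ ‖paleyForm p (S \ S₁) w‖ + ‖paleyForm p S₁ w‖ +
          ‖∑ a ∈ S \ S₁, ∑ b ∈ S₁, ((legendreSym p ((a : ℤ) + b) : ℤ) : ℂ) * w a * w b‖ +
          ‖∑ a ∈ S₁, ∑ b ∈ S \ S₁, ((legendreSym p ((a : ℤ) + b) : ℤ) : ℂ) * w a * w b‖ := by
          refine (norm_add_le _ _).trans (add_le_add ((norm_add_le _ _).trans (add_le_add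
            (norm_add_le _ _) le_rfl)) le_rfl)
      _ ≤ θ * k * Y ^ 2 + θ * X ^ 2 + θ * Real.sqrt k * X * Y + θ * Real.sqrt k * X * Y := by
          linarith [hQ', hQ1, hB, hB']
      _ = θ * (X + Real.sqrt k * Y) ^ 2 := by rw [add_sq, mul_pow, hsk]; ring
      _ ≤ θ * (((k : ℝ) + 1) * (X ^ 2 + Y ^ 2)) := by
          apply mul_le_mul_of_nonneg_left _ hθ
          nlinarith [sq_nonneg (Real.sqrt k * X - Y), hsk]
      _ = θ * ((k + 1 : ℕ) : ℝ) * (X ^ 2 + Y ^ 2) := by push_cast; ring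

end Pieces

section Trade

/-- **Monotonicity in the exponents.**  The engine's inequality at `p` with exponents `(κ, δ₁)` implies
it with any weaker pair `κ' ≤ κ`, `δ₁' ≤ δ₁`. [folklore] -/
theorem flatRIPAt_mono (p : ℕ) [Fact p.Prime] (κ δ₁ κ' δ₁' : ℝ) (hκ : κ' ≤ κ) (hδ : δ₁' ≤ δ₁)
    (hB : ∀ (S : Finset ℕ), (∀ a ∈ S, a < p) → (S.card : ℝ) ≤ (p : ℝ) ^ (1 / 2 + δ₁) →
      ∀ (w : ℕ → ℂ), ‖paleyForm p S w‖ ≤ (p : ℝ) ^ (1 / 2 - κ) * ∑ a ∈ S, ‖w a‖ ^ 2) :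
    ∀ (S : Finset ℕ), (∀ a ∈ S, a < p) → (S.card : ℝ) ≤ (p : ℝ) ^ (1 / 2 + δ₁') →
      ∀ (w : ℕ → ℂ), ‖paleyForm p S w‖ ≤ (p : ℝ) ^ (1 / 2 - κ') * ∑ a ∈ S, ‖w a‖ ^ 2 := by
  intro S hS hScard w
  have hp1 : (1 : ℝ) ≤ (p : ℝ) := by exact_mod_cast (Fact.out : p.Prime).one_lt.le
  have hcard : (S.card : ℝ) ≤ (p : ℝ) ^ (1 / 2 + δ₁) :=
    hScard.trans (Real.rpow_le_rpow_of_exponent_le hp1 (by linarith))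
  refine (hB S hS hcard w).trans (mul_le_mul_of_nonneg_right ?_ (sum_nonneg fun _ _ => sq_nonneg _))
  exact Real.rpow_le_rpow_of_exponent_le hp1 (by linarith)

/-- `m ≤ (m / h + 1) · h` for naturals (`h > 0`). [folklore] -/
theorem le_div_add_one_mul (m h : ℕ) (hh : 0 < h) : m ≤ (m / h + 1) * h := by
  have h1 := Nat.div_add_mod m h
  have h2 := Nat.mod_lt m hh
  nlinarith

/-- **Trading support for saving, at one prime.**  If the engine's inequality holds at `p` with exponents
`(κ, δ₁)` and `p^{1/2+δ₁} ≥ 4`, then for every `η ≥ 0` and every `S ⊆ [0,p)` with `#S ≤ p^{1/2+δ₁+η}`: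
`|Q_p(S,w)| ≤ 5·p^{η}·p^{1/2−κ}·Σ_{a∈S}|w_a|²` (cut `S` into `≤ 4p^η + 1` pieces of size `≤ p^{1/2+δ₁}/2`
and apply the block-norm bound `norm_paleyForm_pieces_le`).  In RIP language: restricted-isometry
constants grow at most linearly in the order. [folklore] -/
theorem flatRIPAt_trade (p : ℕ) [Fact p.Prime] (κ δ₁ η : ℝ) (hη : 0 ≤ η)
    (hB : ∀ (S : Finset ℕ), (∀ a ∈ S, a < p) → (S.card : ℝ) ≤ (p : ℝ) ^ (1 / 2 + δ₁) →
      ∀ (w : ℕ → ℂ), ‖paleyForm p S w‖ ≤ (p : ℝ) ^ (1 / 2 - κ) * ∑ a ∈ S, ‖w a‖ ^ 2)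
    (h4 : (4 : ℝ) ≤ (p : ℝ) ^ (1 / 2 + δ₁))
    (S : Finset ℕ) (hS : ∀ a ∈ S, a < p) (hScard : (S.card : ℝ) ≤ (p : ℝ) ^ (1 / 2 + δ₁ + η))
    (w : ℕ → ℂ) :
    ‖paleyForm p S w‖ ≤ 5 * (p : ℝ) ^ η * (p : ℝ) ^ (1 / 2 - κ) * ∑ a ∈ S, ‖w a‖ ^ 2 := by
  have hprime : p.Prime := Fact.out
  have hp0 : (0 : ℝ) < (p : ℝ) := by exact_mod_cast hprime.pos
  have hp1 : (1 : ℝ) ≤ (p : ℝ) := by exact_mod_cast hprime.one_lt.le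
  set K : ℝ := (p : ℝ) ^ (1 / 2 + δ₁) with hK
  set h : ℕ := ⌊K / 2⌋₊ with hh
  have hhle : (h : ℝ) ≤ K / 2 := Nat.floor_le (by linarith)
  have hhgt : K / 2 < (h : ℝ) + 1 := Nat.lt_floor_add_one _
  have hh1 : (1 : ℝ) < (h : ℝ) := by linarith
  have hhpos : 0 < h := by exact_mod_cast (zero_lt_one.trans hh1)
  have hhposR : (0 : ℝ) < (h : ℝ) := by exact_mod_cast hhpos
  have hhK : K / 4 ≤ (h : ℝ) := by linarith
  set θ : ℝ := (p : ℝ) ^ (1 / 2 - κ) with hθ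
  have hθ0 : 0 ≤ θ := Real.rpow_nonneg hp0.le _
  -- every sub-support of size `≤ 2h ≤ K` carries the bound `θ`
  have hQ : ∀ T ⊆ S, T.card ≤ 2 * h → ∀ w : ℕ → ℂ, ‖paleyForm p T w‖ ≤ θ * ∑ a ∈ T, ‖w a‖ ^ 2 := by
    intro T hT hTcard w'
    refine hB T (fun a ha => hS a (hT ha)) ?_ w'
    have : (T.card : ℝ) ≤ 2 * (h : ℝ) := by exact_mod_cast hTcard
    linarith
  -- number of pieces
  set k : ℕ := S.card / h + 1 with hk
  have hSk : S.card ≤ k * h := le_div_add_one_mul S.card h hhpos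
  have hmain := norm_paleyForm_pieces_le p θ hθ0 h S hQ k S subset_rfl hSk w
  -- `k ≤ 4 p^η + 1 ≤ 5 p^η`
  have hpη1 : (1 : ℝ) ≤ (p : ℝ) ^ η := Real.one_le_rpow hp1 hη
  have hkR : (k : ℝ) ≤ 5 * (p : ℝ) ^ η := by
    have hdiv : ((S.card / h : ℕ) : ℝ) ≤ (S.card : ℝ) / (h : ℝ) := Nat.cast_div_le
    have hk' : (k : ℝ) = ((S.card / h : ℕ) : ℝ) + 1 := by rw [hk]; push_cast; ring
    have hratio : (S.card : ℝ) / (h : ℝ) ≤ 4 * (p : ℝ) ^ η := by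
      rw [div_le_iff₀ hhposR]
      have hsplit : (p : ℝ) ^ (1 / 2 + δ₁ + η) = (p : ℝ) ^ η * K := by
        rw [hK, ← Real.rpow_add hp0]; ring_nf
      have h1 : (S.card : ℝ) ≤ (p : ℝ) ^ η * K := hsplit ▸ hScard
      have h2 : (p : ℝ) ^ η * K ≤ 4 * (p : ℝ) ^ η * (h : ℝ) := by
        have := mul_le_mul_of_nonneg_left hhK (Real.rpow_nonneg hp0.le η)
        linarith
      linarith
    rw [hk']
    linarith
  calc ‖paleyForm p S w‖ ≤ θ * k * ∑ a ∈ S, ‖w a‖ ^ 2 := hmain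
    _ ≤ θ * (5 * (p : ℝ) ^ η) * ∑ a ∈ S, ‖w a‖ ^ 2 := by
        apply mul_le_mul_of_nonneg_right _ (sum_nonneg fun _ _ => sq_nonneg _)
        exact mul_le_mul_of_nonneg_left hkR hθ0
    _ = 5 * (p : ℝ) ^ η * (p : ℝ) ^ (1 / 2 - κ) * ∑ a ∈ S, ‖w a‖ ^ 2 := by rw [hθ]; ring

/-- **Trading support for saving (asymptotic form).**  If the engine's inequality holds with exponents
`(κ, δ₁)`, `δ₁ ≥ 0`, at all primes `p ≥ p₁`, then for every `η > 0` it holds with exponents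
`(κ − 2η, δ₁ + η)` at all large primes: a `p^{−κ}`-flat Paley–Hankel matrix on supports `≤ p^{1/2+δ₁}`
is `p^{−(κ−2η)}`-flat on supports `≤ p^{1/2+δ₁+η}` (the factor `5p^η` of `flatRIPAt_trade` is
absorbed by the second `η`).  With `flatRIPAt_mono`: if `(κ, δ₁)` is admissible then so is every
`(κ', δ₁')` with `0 < κ' ≤ κ − 2·max(δ₁' − δ₁, 0)`, `δ₁' > 0` — the engine is essentially ONE-PARAMETRIC:
what matters is the saving `κ` just above the square-root scale; support is bought back at rate `≤ 2`.
[folklore] -/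
theorem flatRIP_trade (κ δ₁ : ℝ) (hδ₁ : 0 ≤ δ₁) (p₁ : ℕ)
    (hB : ∀ (p : ℕ) [Fact p.Prime], p₁ ≤ p →
      ∀ (S : Finset ℕ), (∀ a ∈ S, a < p) → (S.card : ℝ) ≤ (p : ℝ) ^ (1 / 2 + δ₁) →
      ∀ (w : ℕ → ℂ), ‖paleyForm p S w‖ ≤ (p : ℝ) ^ (1 / 2 - κ) * ∑ a ∈ S, ‖w a‖ ^ 2)
    (η : ℝ) (hη : 0 < η) :
    ∃ p₂ : ℕ, ∀ (p : ℕ) [Fact p.Prime], p₂ ≤ p →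
      ∀ (S : Finset ℕ), (∀ a ∈ S, a < p) → (S.card : ℝ) ≤ (p : ℝ) ^ (1 / 2 + (δ₁ + η)) →
      ∀ (w : ℕ → ℂ), ‖paleyForm p S w‖ ≤ (p : ℝ) ^ (1 / 2 - (κ - 2 * η)) * ∑ a ∈ S, ‖w a‖ ^ 2 := by
  obtain ⟨N, hN⟩ : ∃ N : ℕ, (5 : ℝ) ^ (1 / η) ≤ (N : ℝ) := ⟨_, Nat.le_ceil _⟩
  refine ⟨max p₁ (max N 16), ?_⟩
  intro p _ hp S hS hScard w
  have hprime : p.Prime := Fact.out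
  have hp0 : (0 : ℝ) < (p : ℝ) := by exact_mod_cast hprime.pos
  have hp1 : (1 : ℝ) ≤ (p : ℝ) := by exact_mod_cast hprime.one_lt.le
  obtain ⟨hpp₁, hpN', hp16'⟩ : p₁ ≤ p ∧ N ≤ p ∧ 16 ≤ p := by simp only [max_le_iff] at hp; tauto
  have hpN : (N : ℝ) ≤ p := by exact_mod_cast hpN'
  have hp16 : (16 : ℝ) ≤ p := by exact_mod_cast hp16'
  have h5 : (5 : ℝ) ≤ (p : ℝ) ^ η := by
    have h0 : (0 : ℝ) ≤ (5 : ℝ) ^ (1 / η) := Real.rpow_nonneg (by norm_num) _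
    calc (5 : ℝ) = ((5 : ℝ) ^ (1 / η)) ^ η := by
          rw [one_div, Real.rpow_inv_rpow (by norm_num) hη.ne']
      _ ≤ (p : ℝ) ^ η := Real.rpow_le_rpow h0 (hN.trans hpN) hη.le
  have h4 : (4 : ℝ) ≤ (p : ℝ) ^ (1 / 2 + δ₁) := by
    have h16 : Real.sqrt 16 = 4 := by
      rw [show (16 : ℝ) = 4 ^ 2 by norm_num, Real.sqrt_sq (by norm_num)]
    calc (4 : ℝ) = Real.sqrt 16 := h16.symm
      _ ≤ Real.sqrt p := Real.sqrt_le_sqrt hp16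
      _ = (p : ℝ) ^ (1 / 2 : ℝ) := Real.sqrt_eq_rpow _
      _ ≤ (p : ℝ) ^ (1 / 2 + δ₁) := Real.rpow_le_rpow_of_exponent_le hp1 (by linarith)
  have hScard' : (S.card : ℝ) ≤ (p : ℝ) ^ (1 / 2 + δ₁ + η) := by rwa [← add_assoc] at hScard
  have h := flatRIPAt_trade p κ δ₁ η hη.le (hB p hpp₁) h4 S hS hScard' w
  refine h.trans (mul_le_mul_of_nonneg_right ?_ (sum_nonneg fun _ _ => sq_nonneg _))
  -- `5 p^η p^{1/2−κ} ≤ p^η p^η p^{1/2−κ} = p^{1/2−(κ−2η)}`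
  have hsplit : (p : ℝ) ^ (1 / 2 - (κ - 2 * η)) = (p : ℝ) ^ η * (p : ℝ) ^ η * (p : ℝ) ^ (1 / 2 - κ) := by
    rw [← Real.rpow_add hp0, ← Real.rpow_add hp0]; ring_nf
  rw [hsplit]
  have hnn : 0 ≤ (p : ℝ) ^ η * (p : ℝ) ^ (1 / 2 - κ) := by positivity
  nlinarith

/-- **Closure property of the admissible region.**  Call `(κ, δ₁)` admissible when `κ, δ₁ > 0` and the
engine's inequality holds with `(κ, δ₁)` at all large primes (`stub_paleyFlatRIP`: some pair is
admissible).  If `(κ, δ₁)` is admissible then so is `(κ − 2η, δ₁ + η)` for every `0 < η < κ/2`.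
[folklore] -/
theorem flatRIP_admissible_trade (κ δ₁ η : ℝ) (hδ₁ : 0 < δ₁) (hη : 0 < η) (hηκ : 2 * η < κ)
    (hB : ∃ p₁ : ℕ, ∀ (p : ℕ) [Fact p.Prime], p₁ ≤ p →
      ∀ (S : Finset ℕ), (∀ a ∈ S, a < p) → (S.card : ℝ) ≤ (p : ℝ) ^ (1 / 2 + δ₁) →
      ∀ (w : ℕ → ℂ), ‖paleyForm p S w‖ ≤ (p : ℝ) ^ (1 / 2 - κ) * ∑ a ∈ S, ‖w a‖ ^ 2) :
    0 < κ - 2 * η ∧ 0 < δ₁ + η ∧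
    ∃ p₂ : ℕ, ∀ (p : ℕ) [Fact p.Prime], p₂ ≤ p →
      ∀ (S : Finset ℕ), (∀ a ∈ S, a < p) → (S.card : ℝ) ≤ (p : ℝ) ^ (1 / 2 + (δ₁ + η)) →
      ∀ (w : ℕ → ℂ), ‖paleyForm p S w‖ ≤ (p : ℝ) ^ (1 / 2 - (κ - 2 * η)) * ∑ a ∈ S, ‖w a‖ ^ 2 := by
  obtain ⟨p₁, hB⟩ := hB
  exact ⟨by linarith, by linarith, flatRIP_trade κ δ₁ hδ₁.le p₁ hB η hη⟩

end Trade

end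

end Summit.ValiantsHypothesis.ValiantsHypothesis.Theorems.FeketeSOSHardPaleyRIP
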